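import Summits.PneNP.PneNP.Theorems.ChebyshevTracialDesignInSetSymmetrization
import Summits.PneNP.PneNP.Theorems.ChebyshevTracialDesignTiltedSmallBlockTools
import HarnessLib

/-!
# Cell pnp-psdrank, route `ChebyshevTracialDesign`: pricing one piece with a JUNTA mask of the in-set (brick 157d; crux
# `TracialDecayExp20`, stmt-PneNP-19878)

Brick 157d (prover g31; MEMO-34 §4(b)). Brick 151a's piece lemmas (`piece_abs_le`, `piece_main_le`: a polynomially weighted level sum of
the shell profile of a bounded univariate mask `ψ(|U∩H|)` on a block without internal edges is pure remainder when the weight vanishes at the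
virtual level; the main piece is priced one-sidedly) for an ARBITRARY JUNTA MASK `f(U ∩ H)` of the in-set: by brick 157c
(`shellInAvg_inset_eq`) the shell average of `f(U ∩ H)` is the shell average of its symmetrisation `f̄(|U ∩ H|)`, a univariate mask with
`|f̄| ≤ G` (`abs_symm_le`) and `f̄ ≥ 0` (`symm_nonneg`). Bricks 158a §2 (`piece_abs_le₂`/`piece_main_le₂`, bivariate masks) are the
special case `f(I) = Φ(|I∩H₁|,|I∩H₂|)`; this is the per-piece tool of a `k`-block / junta version of the tilted small-block line.

* **`piece_abs_le_inset`**, **`piece_main_le_inset`**.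
WHAT THIS FILE DOES NOT DO: any expansion or assembly; anything on `TracialDecayExp20` itself, psd rank of P_PM(K_n), or P vs NP.
[cite: Rothvoss2017, §2 (PDF p. 6)] [cite: Agarwal2000DifferenceEquations, Remark 1.8.1 (1.8.8)] [cite: RollinRoss2010, §3 (Lemma 3.1)]
Stature: support/instrument (kernel lane, no defs, axioms standard). Supports stmt-PneNP-19878.
-/

set_option linter.dupNamespace false -- `Summit.PneNP.PneNP.…`: summit = sub-problem (D-0017)

noncomputable section

namespace Summit.PneNP.PneNP.Theorems.ChebyshevTracialDesignInSetPieces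

open Finset Polynomial Literature.Barriers.PneNP Literature.Combinatorics.Optimization
open Literature.Combinatorics.Optimization.ShellStep
open Summit.PneNP.PneNP.Theorems.ChebyshevTracialDesignTiltedSmallBlockTools (piece_abs_le piece_main_le)
open Summit.PneNP.PneNP.Theorems.ChebyshevTracialDesignInSetSymmetrization (shellInAvg_inset_eq abs_symm_le symm_nonneg)

variable {n : ℕ} {π : Fin n → Fin n} (hπ : ∀ v, π (π v) = v) (hπ' : ∀ v, π v ≠ v)
include hπ hπ'

/-- **A junta piece with vanishing virtual weight is pure remainder.** As brick 151a `piece_abs_le`, for a block `H` with no edge of `S`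
inside and `b' ≤ b` edges meeting it, and a junta mask `|f(I)| ≤ G` for `I ⊆ S ∩ H`:
`|Σ_c w_c p(c)·E_{Shell_S(2s₀+c₀, c−g)}[f(U ∩ H)]| ≤ B_v·P·C((T−1)/2, D′+1)·G·(¼(b/R)²e^{3b/R})^{D′+1}`.
[cite: Agarwal2000DifferenceEquations, Remark 1.8.1 (1.8.8)] [cite: RollinRoss2010, §3 (Lemma 3.1)] -/
theorem piece_abs_le_inset {t T D : ℕ} {Bv : ℝ} {C : Finset ℕ} {w : ℕ → ℝ} (hdes : IsExactDesign n t T D Bv C w)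
    {S : Finset (Fin n)} (hS : ∀ v ∈ S, π v ∈ S) {N' : ℕ} (hN : S.card = 2 * N')
    (H : Finset (Fin n)) (h0 : (reps π (vAA π S H)).card = 0)
    {b b' : ℕ} (hb' : (reps π (vBH π S H ∪ vBN π S H)).card = b') (hb'b : b' ≤ b)
    {s₀ c₀ i₀ g D' R : ℕ} (hc₀ : 2 * i₀ + 1 = g + c₀) (hR : 1 ≤ R)
    (hR1 : R + 3 * (D' + 1) + b + (T - 1) / 2 ≤ s₀ + 1)
    (hR2 : R + 3 * (D' + 1) + b + s₀ + (T - 1) / 2 + c₀ ≤ N')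
    (f : Finset (Fin n) → ℝ) {G : ℝ} (hG0 : 0 ≤ G) (hG : ∀ I ⊆ S ∩ H, |f I| ≤ G)
    (p : ℝ[X]) (hdeg : p.natDegree + D' ≤ D) (hpz : p.eval 0 = 0)
    (hp0 : ∀ c ∈ C, c < 2 * i₀ + 1 → p.eval (c : ℝ) = 0) {P : ℝ} (hP : ∀ c ∈ C, |p.eval (c : ℝ)| ≤ P) :
    |∑ c ∈ C, w c * (p.eval (c : ℝ) *
        ((∑ U ∈ shellIn π S (2 * s₀ + c₀) (c - g), f (U ∩ H)) / ((shellIn π S (2 * s₀ + c₀) (c - g)).card : ℝ)))| ≤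
      Bv * P * ((((T - 1) / 2).choose (D' + 1) : ℕ) : ℝ) *
        (G * ((1 / 4 : ℝ) * ((b : ℝ) / R) ^ 2 * Real.exp (3 * b / R)) ^ (D' + 1)) := by
  have hno := noHH_of_card_reps_vAA_eq_zero hπ hπ' hS H h0
  set ψ : ℤ → ℝ := fun x => (∑ I ∈ (S ∩ H).powersetCard x.toNat, f I) / (((S ∩ H).card.choose x.toNat : ℕ) : ℝ) with hψ
  have hψG : ∀ x ∈ Icc (0 : ℤ) ((2 * s₀ + c₀ : ℕ) : ℤ), |ψ x| ≤ G := fun x _ => abs_symm_le f hG0 hG _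
  have hrw : ∀ c : ℕ, (∑ U ∈ shellIn π S (2 * s₀ + c₀) (c - g), f (U ∩ H)) /
      ((shellIn π S (2 * s₀ + c₀) (c - g)).card : ℝ) =
      (∑ U ∈ shellIn π S (2 * s₀ + c₀) (c - g), ψ ((U ∩ H).card : ℤ)) / ((shellIn π S (2 * s₀ + c₀) (c - g)).card : ℝ) := by
    intro c
    rw [shellInAvg_inset_eq hπ hπ' hS hno _ _ f]
    simp only [hψ, Int.toNat_natCast]
  simp_rw [hrw]
  exact piece_abs_le hπ hπ' hdes hS hN H h0 hb' hb'b hc₀ hR hR1 hR2 ψ hψG p hdeg hpz hp0 hP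

/-- **The junta main piece** (`g = 0`, odd reduced cut `2s₀+1`, virtual weight `p(0) ≥ 0`, mask `0 ≤ f ≤ G` on the subsets of `S ∩ H`):
one-sidedly `Σ_c w_c p(c)·E_{Shell_S(2s₀+1, c)}[f(U ∩ H)] ≤ B_v·P·C((T−1)/2, D′+1)·G·(¼(b/R)²e^{3b/R})^{D′+1}`; needs `(b/R)²e^{3b/R} ≤ 2`.
[cite: Agarwal2000DifferenceEquations, Remark 1.8.1 (1.8.8)] [cite: RollinRoss2010, §3 (Lemma 3.1)] -/
theorem piece_main_le_inset {t T D : ℕ} {Bv : ℝ} {C : Finset ℕ} {w : ℕ → ℝ} (hdes : IsExactDesign n t T D Bv C w)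
    {S : Finset (Fin n)} (hS : ∀ v ∈ S, π v ∈ S) {N' : ℕ} (hN : S.card = 2 * N')
    (H : Finset (Fin n)) (h0 : (reps π (vAA π S H)).card = 0)
    {b b' : ℕ} (hb' : (reps π (vBH π S H ∪ vBN π S H)).card = b') (hb'b : b' ≤ b)
    {s₀ D' R : ℕ} (hR : 1 ≤ R)
    (hR1 : R + 3 * (D' + 1) + b + (T - 1) / 2 ≤ s₀ + 1)
    (hR2 : R + 3 * (D' + 1) + b + s₀ + (T - 1) / 2 + 1 ≤ N')
    (hq : ((b : ℝ) / R) ^ 2 * Real.exp (3 * b / R) ≤ 2)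
    (f : Finset (Fin n) → ℝ) {G : ℝ} (hG0 : 0 ≤ G) (hG : ∀ I ⊆ S ∩ H, |f I| ≤ G) (hf0 : ∀ I ⊆ S ∩ H, 0 ≤ f I)
    (p : ℝ[X]) (hdeg : p.natDegree + D' ≤ D) (hp0 : 0 ≤ p.eval 0) {P : ℝ} (hP : ∀ c ∈ C, |p.eval (c : ℝ)| ≤ P) :
    ∑ c ∈ C, w c * (p.eval (c : ℝ) *
        ((∑ U ∈ shellIn π S (2 * s₀ + 1) c, f (U ∩ H)) / ((shellIn π S (2 * s₀ + 1) c).card : ℝ))) ≤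
      Bv * P * ((((T - 1) / 2).choose (D' + 1) : ℕ) : ℝ) *
        (G * ((1 / 4 : ℝ) * ((b : ℝ) / R) ^ 2 * Real.exp (3 * b / R)) ^ (D' + 1)) := by
  have hno := noHH_of_card_reps_vAA_eq_zero hπ hπ' hS H h0
  set ψ : ℤ → ℝ := fun x => (∑ I ∈ (S ∩ H).powersetCard x.toNat, f I) / (((S ∩ H).card.choose x.toNat : ℕ) : ℝ) with hψ
  have hψG : ∀ x ∈ Icc (0 : ℤ) ((2 * s₀ + 1 : ℕ) : ℤ), |ψ x| ≤ G := fun x _ => abs_symm_le f hG0 hG _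
  have hψ0 : ∀ x ∈ Icc (0 : ℤ) ((2 * s₀ + 1 : ℕ) : ℤ), 0 ≤ ψ x := fun x _ => symm_nonneg f hf0 _
  have hrw : ∀ c : ℕ, (∑ U ∈ shellIn π S (2 * s₀ + 1) c, f (U ∩ H)) / ((shellIn π S (2 * s₀ + 1) c).card : ℝ) =
      (∑ U ∈ shellIn π S (2 * s₀ + 1) c, ψ ((U ∩ H).card : ℤ)) / ((shellIn π S (2 * s₀ + 1) c).card : ℝ) := by
    intro c
    rw [shellInAvg_inset_eq hπ hπ' hS hno _ _ f]
    simp only [hψ, Int.toNat_natCast]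
  simp_rw [hrw]
  exact piece_main_le hπ hπ' hdes hS hN H h0 hb' hb'b hR hR1 hR2 hq ψ hψG hψ0 p hdeg hp0 hP

end Summit.PneNP.PneNP.Theorems.ChebyshevTracialDesignInSetPieces

end
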